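import Literature.MathematicalPhysics.QuantumFieldTheory.Balaban1983to89.B9Thm311DeltaPrimeAsymm

/-!
# `Balaban1983to89.B9Thm311DeltaPrimeWitness` — located finding R7, THE CONFIGURATION WITNESS: an explicit one-plaquette unitary background `U₀` at which
# def-Y's v2∕v3 letter `deltaPrimeAY i (parSY i) U₀` is NOT symmetric (referee ref-A g15 WATCH-S, ASK (ii), discharged in the kernel)

T. Bałaban, *Propagators for lattice gauge theories in a background field*, Commun. Math. Phys. **99** (1985) 389–434
[`Balaban1985BackgroundPropagators`, "B9"]; [4] = *Propagators … II* [`Balaban1984PropagatorsII`].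

statement-level skeleton of published theorems with citation tags; proofs where landed; nothing here is a claim about the
Yang–Mills mass gap

THE PRINTED LOCUS (p. 397, (3.40)): *"Γ_{x,x′} is a shortest contour connecting points x and x′"*; (3.3) p. 391: `U(Γ) = U(b₁)⋯U(bₙ)`; (3.24) p. 394:
Δ′_a(U) is given by a quadratic form (symmetric).  `B9Thm311DeltaPrimeAsymm.not_isSymmTr_deltaPrimeAY_parSY` reduced the asymmetry of the unrepaired
letter (taxicab transporters `parSY`, legs in the axis order both ways) to ONE configuration hypothesis `hhol` (the in-block rectangle holonomy at one site
acts non-trivially by conjugation).  THIS FILE DISCHARGES `hhol`: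

* §1 (torus `Site P 0`, any `Params` with side `≥ 3`) `taxiLegV_of_eq ∕ taxiRun_of_eq` (empty legs), `taxiLegV_fwd ∕ taxiLegV_bwd` (unit legs), ★ `parTaxiV_plaquette_out`:
  `U(Γ_{x, x+e_{μ₀}+e_{μ₁}}) = U_{μ₀}(x)·U_{μ₁}(x+e_{μ₀})`, ★ `parTaxiV_plaquette_back`: `U(Γ_{x+e_{μ₀}+e_{μ₁}, x}) = U_{μ₀}(x+e_{μ₁})⁻¹·U_{μ₁}(x)⁻¹` (the OTHER
  two sides — the axis-ordered taxicab contour is not reversal-symmetric), the one-bond configuration `bondCfg`, ★★ `parTaxiV_bondCfg` (out `= V`, back `= 1`);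
* §2 the witness matrix `witDiag ∕ witV = diag(−1, 1, …, 1)` (unitary, self-inverse, `R(V)E₀₁ = −E₀₁ ≠ E₀₁`: `R_witV_ne`);
* §3 (k-level index `i`, dimension `d′ + 2`) `three_le_sitesPerDir`, `finRange_eq`, the chart points `origT ∕ diagT` (`0`, `e₀ + e₁`), ★ `cornerY_diagT` (the block
  corner of `e₀+e₁` is `0`: blocks have side `L^{lev} ≥ 5`), `parSY_boxEquiv`, `witCfg`, `parSY_witCfg_out ∕ _back`, ★★★ `not_isSymmTr_deltaPrimeAY_parSY_witCfg`,
  ★★★ `exists_not_isSymmTr_deltaPrimeAY_parSY` (every index with `d ≥ 1`, every `N ≥ 2`).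

HONEST SCOPE.  An explicit unitary-valued (NOT (3.35)-small: `‖V − 1‖ = 2`) configuration; the (3.35)-regular rescaling `V_ε = diag(e^{iε}, e^{−iε}, 1, …)`
has the same contour algebra (`parTaxiV_bondCfg` is stated for any unit `V`) and is left recorded.  Finite-dimensional algebra; nothing of [B9] asserted;
count-neutral; nothing continuum, nothing about the mass gap.  The v4 record (`parSymY`) is symmetric (`B9Thm311DeltaPrimeSymm`, `B9Thm311SymmAtRecordV4`).
Cell `pub-ymgap` (HUMAN RULING D-0062), Track A node N06 [B9], seat `pub-ymgap-dag-n06-j` (harness re-seat gen 6), 2026-08-27.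
-/

namespace Literature.MathematicalPhysics.QuantumFieldTheory.Balaban1983to89.B9Thm311DeltaPrimeWitness

open Literature.MathematicalPhysics.QuantumFieldTheory.Balaban1983to89
open B9Thm311ReadingCoords B9Thm311AdjointAtLetters B9Thm311DeltaPrimeSymm B9Thm311AdjointPairs B9Thm311DeltaPrimeAsymm Node00
open B6KLevelCensusIndexV1 B6Geom246MultiLevelBox B6MultiLevelBoxOperator B9PinMembersKLevelV1 B7Prop2SpecialUnitary
open scoped Matrix

noncomputable section

/-! ## §1 Plaquette transport of the axis-ordered taxicab contour (torus level) -/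

section Taxi

open B9BackgroundsKLevelV1

variable {P : Params} {𝔸 : Type} [Ring 𝔸]

/-- a run with one more leg (`foldl`). [cite: Balaban1985BackgroundPropagators, (3.40) p.397, bookkeeping] -/
theorem taxiRun_cons (U : CfgV1 P 𝔸) (x' : Site P 0) (μ : Fin P.d) (l : List (Fin P.d)) (s : Site P 0 × 𝔸ˣ) :
    taxiRun U x' (μ :: l) s = taxiRun U x' l (taxiLegV U x' s μ) := rfl

/-- a leg in a direction where the contour already sits at the target coordinate is empty. [cite: Balaban1985BackgroundPropagators, (3.40) p.397, bookkeeping] -/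
theorem taxiLegV_of_eq (U : CfgV1 P 𝔸) (x' : Site P 0) (s : Site P 0 × 𝔸ˣ) (μ : Fin P.d) (h : x' μ = s.1 μ) :
    taxiLegV U x' s μ = s := by
  unfold taxiLegV
  simp [h]

/-- a run over directions where the contour already sits at the target coordinates is empty. [cite: Balaban1985BackgroundPropagators, (3.40) p.397, bookkeeping] -/
theorem taxiRun_of_eq (U : CfgV1 P 𝔸) (x' : Site P 0) (l : List (Fin P.d)) (s : Site P 0 × 𝔸ˣ) (h : ∀ μ ∈ l, x' μ = s.1 μ) :
    taxiRun U x' l s = s := by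
  induction l generalizing s with
  | nil => rfl
  | cons μ l ih =>
    rw [taxiRun_cons, taxiLegV_of_eq U x' s μ (h μ (by simp))]
    exact ih s fun ν hν => h ν (by simp [hν])

/-- a leg towards a target ONE step ahead: one forward bond `U_μ(w)` (torus side `≥ 3`, so forward is the shorter way).
[cite: Balaban1985BackgroundPropagators, (3.3) p.391, (3.40) p.397, bookkeeping] -/
theorem taxiLegV_fwd (h3 : 3 ≤ P.sitesPerDir 0) (U : CfgV1 P 𝔸) (x' : Site P 0) (s : Site P 0 × 𝔸ˣ) (μ : Fin P.d) (h : x' μ = s.1 μ + 1) :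
    taxiLegV U x' s μ = (s.1.shift μ, s.2 * U μ s.1) := by
  have hF : Fact (1 < P.sitesPerDir 0) := ⟨by omega⟩
  have h1 : (x' μ - s.1 μ).val = 1 := by rw [h, add_sub_cancel_left, ZMod.val_one]
  have h2 : (s.1 μ - x' μ).val = P.sitesPerDir 0 - 1 := by
    rw [h, sub_add_cancel_left, ZMod.neg_val, if_neg one_ne_zero, ZMod.val_one]
  unfold taxiLegV
  rw [if_pos (by rw [h1, h2]; omega)]
  simp only [h1, Function.iterate_one, parFwdV_succ, parFwdV_zero, mul_one]

/-- a leg towards a target ONE step behind: one backward bond `U_μ(w − e_μ)⁻¹` (torus side `≥ 3`).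
[cite: Balaban1985BackgroundPropagators, (3.3), (3.8) pp.391–392, (3.40) p.397, bookkeeping] -/
theorem taxiLegV_bwd (h3 : 3 ≤ P.sitesPerDir 0) (U : CfgV1 P 𝔸) (x' : Site P 0) (s : Site P 0 × 𝔸ˣ) (μ : Fin P.d) (h : x' μ = s.1 μ - 1) :
    taxiLegV U x' s μ = (s.1.unshift μ, s.2 * (U μ (s.1.unshift μ))⁻¹) := by
  have hF : Fact (1 < P.sitesPerDir 0) := ⟨by omega⟩
  have h1 : (x' μ - s.1 μ).val = P.sitesPerDir 0 - 1 := by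
    rw [h, sub_sub_cancel_left, ZMod.neg_val, if_neg one_ne_zero, ZMod.val_one]
  have h2 : (s.1 μ - x' μ).val = 1 := by rw [h, sub_sub_cancel, ZMod.val_one]
  unfold taxiLegV
  rw [if_neg (by rw [h1, h2]; omega)]
  simp only [h2, Function.iterate_one, parBwdV_succ, parBwdV_zero, mul_one]

/-- two unit steps `x → x + e_{μ₀} → x + e_{μ₀} + e_{μ₁}` read on the coordinates. [folklore] -/
private theorem shift_shift_apply_fst (x : Site P 0) {μ₀ μ₁ : Fin P.d} (hne : μ₀ ≠ μ₁) : ((x.shift μ₀).shift μ₁) μ₀ = x μ₀ + 1 := by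
  simp only [Site.shift, Function.update_of_ne hne, Function.update_self]

/-- idem, second coordinate. [folklore] -/
private theorem shift_shift_apply_snd (x : Site P 0) (μ₀ μ₁ : Fin P.d) : ((x.shift μ₀).shift μ₁) μ₁ = (x.shift μ₀) μ₁ + 1 := by
  simp only [Site.shift, Function.update_self]

/-- `(x + e_{μ₀} + e_{μ₁}) − e_{μ₀} = x + e_{μ₁}`. [folklore] -/
private theorem shift_shift_unshift (x : Site P 0) {μ₀ μ₁ : Fin P.d} (hne : μ₀ ≠ μ₁) : ((x.shift μ₀).shift μ₁).unshift μ₀ = x.shift μ₁ := by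
  funext ν
  simp only [Site.unshift, Site.shift]
  rcases eq_or_ne ν μ₀ with rfl | h0
  · rw [Function.update_self, Function.update_of_ne hne, Function.update_of_ne hne, Function.update_self, add_sub_cancel_right]
  · rw [Function.update_of_ne h0]
    rcases eq_or_ne ν μ₁ with rfl | h1
    · rw [Function.update_self, Function.update_self, Function.update_of_ne h0]
    · rw [Function.update_of_ne h1, Function.update_of_ne h0, Function.update_of_ne h1]

/-- `(x + e_μ) − e_μ = x`. [folklore] -/
private theorem shift_unshift (x : Site P 0) (μ : Fin P.d) : (x.shift μ).unshift μ = x := by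
  funext ν
  simp only [Site.unshift, Site.shift]
  rcases eq_or_ne ν μ with rfl | h0
  · rw [Function.update_self, Function.update_self, add_sub_cancel_right]
  · rw [Function.update_of_ne h0, Function.update_of_ne h0]

/-- ★ THE TAXICAB TRANSPORTER ACROSS ONE PLAQUETTE, OUTWARD: from `x` to `x + e_{μ₀} + e_{μ₁}` (`μ₀` the first leg direction, `μ₁` the second) the contour is
`x → x + e_{μ₀} → x + e_{μ₀} + e_{μ₁}` and `U(Γ) = U_{μ₀}(x)·U_{μ₁}(x + e_{μ₀})`. [cite: Balaban1985BackgroundPropagators, (3.3) p.391, (3.40) p.397] -/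
theorem parTaxiV_plaquette_out (h3 : 3 ≤ P.sitesPerDir 0) (U : CfgV1 P 𝔸) (x : Site P 0) {μ₀ μ₁ : Fin P.d} {rest : List (Fin P.d)}
    (hl : List.finRange P.d = μ₀ :: μ₁ :: rest) (hne : μ₀ ≠ μ₁) :
    parTaxiV U x ((x.shift μ₀).shift μ₁) = U μ₀ x * U μ₁ (x.shift μ₀) := by
  unfold parTaxiV
  rw [hl, taxiRun_cons, taxiRun_cons, taxiLegV_fwd h3 U _ (x, 1) μ₀ (shift_shift_apply_fst x hne),
    taxiLegV_fwd h3 U _ _ μ₁ (shift_shift_apply_snd x μ₀ μ₁)]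
  simp only [one_mul]
  rw [taxiRun_of_eq U ((x.shift μ₀).shift μ₁) rest ((x.shift μ₀).shift μ₁, U μ₀ x * U μ₁ (x.shift μ₀)) fun _ _ => rfl]

/-- ★ THE TAXICAB TRANSPORTER ACROSS ONE PLAQUETTE, BACK: from `x + e_{μ₀} + e_{μ₁}` to `x` the contour is `→ x + e_{μ₁} → x` (the OTHER two sides of the
plaquette) and `U(Γ) = U_{μ₀}(x + e_{μ₁})⁻¹·U_{μ₁}(x)⁻¹` — NOT the inverse of the outward transporter unless the plaquette variable is `1`.
[cite: Balaban1985BackgroundPropagators, (3.3), (3.8) pp.391–392, (3.40) p.397] -/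
theorem parTaxiV_plaquette_back (h3 : 3 ≤ P.sitesPerDir 0) (U : CfgV1 P 𝔸) (x : Site P 0) {μ₀ μ₁ : Fin P.d} {rest : List (Fin P.d)}
    (hl : List.finRange P.d = μ₀ :: μ₁ :: rest) (hne : μ₀ ≠ μ₁) :
    parTaxiV U ((x.shift μ₀).shift μ₁) x = (U μ₀ (x.shift μ₁))⁻¹ * (U μ₁ x)⁻¹ := by
  unfold parTaxiV
  have e0 : x μ₀ = ((x.shift μ₀).shift μ₁) μ₀ - 1 := by rw [shift_shift_apply_fst x hne, add_sub_cancel_right]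
  have e1 : x μ₁ = (x.shift μ₁) μ₁ - 1 := by simp only [Site.shift, Function.update_self, add_sub_cancel_right]
  rw [hl, taxiRun_cons, taxiRun_cons, taxiLegV_bwd h3 U x (_, 1) μ₀ e0]
  simp only [shift_shift_unshift x hne]
  rw [taxiLegV_bwd h3 U x _ μ₁ e1]
  simp only [shift_unshift]
  simp only [one_mul]
  rw [taxiRun_of_eq U x rest (x, (U μ₀ (x.shift μ₁))⁻¹ * (U μ₁ x)⁻¹) fun _ _ => rfl]

/-- ★ the ONE-BOND configuration: `V` on the bond `⟨y, y + e_{μ₁}⟩`, `1` on every other bond. [cite: Balaban1985BackgroundPropagators, (3.3) p.391, bookkeeping] -/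
def bondCfg (μ₁ : Fin P.d) (y : Site P 0) (V : 𝔸ˣ) : CfgV1 P 𝔸 := fun μ w => if μ = μ₁ ∧ w = y then V else 1

/-- the one-bond configuration on its bond. [cite: Balaban1985BackgroundPropagators, (3.3) p.391, bookkeeping] -/
theorem bondCfg_self (μ₁ : Fin P.d) (y : Site P 0) (V : 𝔸ˣ) : bondCfg μ₁ y V μ₁ y = V := if_pos ⟨rfl, rfl⟩

/-- the one-bond configuration off its direction. [cite: Balaban1985BackgroundPropagators, (3.3) p.391, bookkeeping] -/
theorem bondCfg_of_ne_dir {μ₁ μ : Fin P.d} (h : μ ≠ μ₁) (y w : Site P 0) (V : 𝔸ˣ) : bondCfg μ₁ y V μ w = 1 := if_neg fun hh => h hh.1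

/-- the one-bond configuration off its source. [cite: Balaban1985BackgroundPropagators, (3.3) p.391, bookkeeping] -/
theorem bondCfg_of_ne_src (μ₁ μ : Fin P.d) {y w : Site P 0} (h : w ≠ y) (V : 𝔸ˣ) : bondCfg μ₁ y V μ w = 1 := if_neg fun hh => h hh.2

/-- values of the one-bond configuration lie in any subgroup containing `V`. [cite: Balaban1985BackgroundPropagators, (3.3) p.391, bookkeeping] -/
theorem bondCfg_mem {G : Subgroup 𝔸ˣ} (μ₁ : Fin P.d) (y : Site P 0) {V : 𝔸ˣ} (hV : V ∈ G) (μ : Fin P.d) (w : Site P 0) : bondCfg μ₁ y V μ w ∈ G := by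
  unfold bondCfg; split_ifs
  · exact hV
  · exact G.one_mem

/-- `x ≠ x + e_μ` on a torus of side `≥ 3`. [folklore] -/
private theorem shift_ne_self (h3 : 3 ≤ P.sitesPerDir 0) (x : Site P 0) (μ : Fin P.d) : x.shift μ ≠ x := by
  have hF : Fact (1 < P.sitesPerDir 0) := ⟨by omega⟩
  intro h
  have hμ := congrFun h μ
  simp only [Site.shift, Function.update_self, add_eq_left] at hμ
  exact one_ne_zero hμ

/-- ★★ THE PLAQUETTE HOLONOMY DEFECT OF THE TAXICAB TABLE: for the one-bond configuration on `⟨x + e_{μ₀}, x + e_{μ₀} + e_{μ₁}⟩` the outward transporter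
`x → x + e_{μ₀} + e_{μ₁}` is `V` and the return transporter is `1`. [cite: Balaban1985BackgroundPropagators, (3.3) p.391, (3.40) p.397] -/
theorem parTaxiV_bondCfg (h3 : 3 ≤ P.sitesPerDir 0) (x : Site P 0) {μ₀ μ₁ : Fin P.d} {rest : List (Fin P.d)}
    (hl : List.finRange P.d = μ₀ :: μ₁ :: rest) (hne : μ₀ ≠ μ₁) (V : 𝔸ˣ) :
    parTaxiV (bondCfg μ₁ (x.shift μ₀) V) x ((x.shift μ₀).shift μ₁) = V ∧ parTaxiV (bondCfg μ₁ (x.shift μ₀) V) ((x.shift μ₀).shift μ₁) x = 1 := by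
  refine ⟨?_, ?_⟩
  · rw [parTaxiV_plaquette_out h3 _ x hl hne, bondCfg_of_ne_dir hne, bondCfg_self, one_mul]
  · rw [parTaxiV_plaquette_back h3 _ x hl hne, bondCfg_of_ne_dir hne, bondCfg_of_ne_src μ₁ μ₁ (shift_ne_self h3 x μ₀).symm, inv_one, one_mul]

end Taxi


/-! ## §2 The witness matrix -/

section WitMatrix

variable {N : ℕ}

/-- ★ the WITNESS MATRIX `V = diag(−1, 1, …, 1)` (unitary, self-inverse, not central for `N ≥ 2`). [folklore] -/
def witDiag (hN : 2 ≤ N) : Matrix (Fin N) (Fin N) ℂ := Matrix.diagonal fun k => if k = ⟨0, by omega⟩ then -1 else 1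

/-- `V² = 1`. [folklore] -/
private theorem witDiag_mul_self (hN : 2 ≤ N) : witDiag hN * witDiag hN = 1 := by
  rw [witDiag, Matrix.diagonal_mul_diagonal, ← Matrix.diagonal_one]
  congr 1; funext k; split_ifs <;> norm_num

/-- `V* = V`. [folklore] -/
private theorem conjTranspose_witDiag (hN : 2 ≤ N) : (witDiag hN)ᴴ = witDiag hN := by
  rw [witDiag, Matrix.diagonal_conjTranspose]
  congr 1; funext k; simp only [Pi.star_apply]; split_ifs <;> simp

/-- `V` is unitary. [folklore] -/
private theorem witDiag_mem_unitary (hN : 2 ≤ N) : witDiag hN ∈ unitary (Matrix (Fin N) (Fin N) ℂ) := by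
  refine Unitary.mem_iff.mpr ⟨?_, ?_⟩ <;> rw [Matrix.star_eq_conjTranspose, conjTranspose_witDiag, witDiag_mul_self]

/-- `V` as a unit. [folklore] -/
def witV (hN : 2 ≤ N) : (Matrix (Fin N) (Fin N) ℂ)ˣ := ⟨witDiag hN, witDiag hN, witDiag_mul_self hN, witDiag_mul_self hN⟩

/-- ★ conjugation by `V` moves the matrix unit `E₀₁` (to `−E₀₁`): `V` is not central. [folklore] -/
private theorem R_witV_ne (hN : 2 ≤ N) :
    B9Eq39Adjoint.R (witV hN) (Matrix.single ⟨0, by omega⟩ ⟨1, by omega⟩ (1 : ℂ)) ≠ Matrix.single ⟨0, by omega⟩ ⟨1, by omega⟩ (1 : ℂ) := by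
  intro h
  have h01 := congrFun (congrFun h ⟨0, by omega⟩) ⟨1, by omega⟩
  rw [B9Eq39Adjoint.R_def] at h01
  change (witDiag hN * Matrix.single ⟨0, by omega⟩ ⟨1, by omega⟩ (1 : ℂ) * witDiag hN : Matrix (Fin N) (Fin N) ℂ) ⟨0, by omega⟩ ⟨1, by omega⟩ = _ at h01
  simp only [witDiag, Matrix.mul_diagonal, Matrix.diagonal_mul, Matrix.single_apply_same, if_true] at h01
  have hne : (⟨1, by omega⟩ : Fin N) ≠ ⟨0, by omega⟩ := by simp
  rw [if_neg hne] at h01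
  norm_num at h01

end WitMatrix

/-! ## §3 The witness at a k-level index -/

section Witness

open B9BackgroundsKLevelV1 B6GlobalChartV1
open scoped Matrix.Norms.L2Operator

variable {ℓ : ℕ} {b₀ b₁ : ℝ} {N : ℕ}

/-- the torus of a k-level index has side `2L^{m+K} ≥ 3` (indeed `≥ 50`). [cite: Balaban1984PropagatorsII, (2.1) p.224, bookkeeping] -/
theorem three_le_sitesPerDir {d : ℕ} {hd : 1 ≤ d + 1} {hL : Odd (ℓ + 1) ∧ 1 < ℓ + 1} (i : KIdx d ℓ hd hL b₀ b₁) :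
    3 ≤ (PV d ℓ i.m i.K hd hL).sitesPerDir 0 := by
  show 3 ≤ 2 * (ℓ + 1) ^ (i.m + i.K - 0)
  have h1 : ℓ + 1 ≤ (ℓ + 1) ^ (i.m + i.K - 0) := Nat.le_self_pow (by have := i.hk; have := i.hk2; omega) _
  have := i.hℓ
  omega

/-- the leg order of the taxicab contour in dimension `d + 1 ≥ 2`: directions `0, 1`, then the rest. [cite: Balaban1985BackgroundPropagators, (3.40) p.397, bookkeeping] -/
theorem finRange_eq (d' : ℕ) : List.finRange (d' + 1 + 1) = (0 : Fin (d' + 1 + 1)) :: 1 :: (List.finRange d').map (Fin.succ ∘ Fin.succ) := by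
  rw [List.finRange_succ, List.finRange_succ, List.map_cons, List.map_map, Fin.succ_zero_eq_one]

variable {d' : ℕ} {hd : 1 ≤ d' + 1 + 1} {hL : Odd (ℓ + 1) ∧ 1 < ℓ + 1} (i : KIdx (d' + 1) ℓ hd hL b₀ b₁)

/-- the torus origin. [cite: Balaban1984PropagatorsII, (2.1) p.224, dictionary] -/
def origT : Site (PV (d' + 1) ℓ i.m i.K hd hL) 0 := fun _ => 0

/-- the site `e₀ + e₁` of the torus (opposite corner of the plaquette at the origin in the `(0,1)` plane). [cite: Balaban1985BackgroundPropagators, (3.3) p.391, dictionary] -/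
def diagT : Site (PV (d' + 1) ℓ i.m i.K hd hL) 0 := ((origT i).shift 0).shift 1

/-- the chart point of `e₀ + e₁` has coordinates in `{0, 1}`. [cite: Balaban1984PropagatorsII, (2.1) p.224, bookkeeping] -/
theorem val_diagT_le (μ : Fin (d' + 1 + 1)) : ((diagT i μ).val : ℤ) ≤ 1 := by
  have hF : Fact (1 < (PV (d' + 1) ℓ i.m i.K hd hL).sitesPerDir 0) := ⟨by have := three_le_sitesPerDir i; omega⟩
  have h10 : (1 : Fin (d' + 1 + 1)) ≠ 0 := by simp
  simp only [diagT, origT, Site.shift, Function.update_apply]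
  split_ifs <;> simp_all [ZMod.val_one]

/-- ★ the corner of the block of the chart point `z = e₀ + e₁` is the chart point of the origin (the block of `z` has side `L^{lev z} ≥ L ≥ 5 > 1`).
[cite: Balaban1984PropagatorsII, (2.1) p.224; Balaban1985BackgroundPropagators, (3.19) p.393, bookkeeping] -/
theorem cornerY_diagT : cornerY i (levY i (boxEquiv i.hN (diagT i))) (boxEquiv i.hN (diagT i)) = boxEquiv i.hN (origT i) := by
  apply Subtype.ext
  funext μ
  rw [cornerY_apply]
  have hlev : 1 ≤ levY i (boxEquiv i.hN (diagT i)) := (toKT i).D.one_le_lev _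
  have hLj : (2 : ℤ) ≤ (((ℓ + 1) ^ levY i (boxEquiv i.hN (diagT i)) : ℕ) : ℤ) := by
    have h1 : ℓ + 1 ≤ (ℓ + 1) ^ levY i (boxEquiv i.hN (diagT i)) := Nat.le_self_pow (by omega) _
    have := i.hℓ
    omega
  have hz : ((boxEquiv i.hN (diagT i) : SiteY i).1) μ = ((diagT i μ).val : ℤ) := by simp
  have h0 : ((boxEquiv i.hN (origT i) : SiteY i).1) μ = 0 := by simp [origT]
  rw [h0, B4Reflection242.blk, hz, Int.ediv_eq_zero_of_lt (by positivity) (lt_of_le_of_lt (val_diagT_le i μ) (by omega)), mul_zero]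

/-- the taxicab table between the chart points is the torus taxicab transporter. [cite: Balaban1985BackgroundPropagators, (3.40) p.397, bookkeeping] -/
theorem parSY_boxEquiv (U : CfgY (Matrix (Fin N) (Fin N) ℂ) i) (x x' : Site (PV (d' + 1) ℓ i.m i.K hd hL) 0) :
    parSY i U (boxEquiv i.hN x) (boxEquiv i.hN x') = parTaxiV U x x' := by
  simp only [parSY, Equiv.symm_apply_apply]

/-- ★★ THE EXPLICIT NON-FLAT CONFIGURATION: `V = diag(−1, 1, …, 1)` on the single bond `⟨e₀, e₀ + e₁⟩`, `1` on every other bond (one excited plaquette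
through the origin in the `(0,1)` plane). [cite: Balaban1985BackgroundPropagators, (3.3) p.391, bookkeeping] -/
def witCfg (hN : 2 ≤ N) : CfgY (Matrix (Fin N) (Fin N) ℂ) i := bondCfg 1 ((origT i).shift 0) (witV hN)

/-- the one-bond configuration is unitary-valued. [cite: Balaban1985BackgroundPropagators, (3.35) p.396 («U with values in G»), bookkeeping] -/
theorem witCfg_mem_unitary (hN : 2 ≤ N) (μ : Fin (d' + 1 + 1)) (y : Site (PV (d' + 1) ℓ i.m i.K hd hL) 0) :
    ((witCfg i hN μ y : (Matrix (Fin N) (Fin N) ℂ)ˣ) : Matrix (Fin N) (Fin N) ℂ) ∈ unitary (Matrix (Fin N) (Fin N) ℂ) := by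
  unfold witCfg bondCfg
  split_ifs
  · exact witDiag_mem_unitary hN
  · rw [Units.val_one]; exact Submonoid.one_mem _

/-- ★ OUTWARD through the excited plaquette: `U₀(Γ_{0, e₀+e₁}) = V`. [cite: Balaban1985BackgroundPropagators, (3.3) p.391, (3.40) p.397] -/
theorem parSY_witCfg_out (hN : 2 ≤ N) : parSY i (witCfg i hN) (boxEquiv i.hN (origT i)) (boxEquiv i.hN (diagT i)) = witV hN := by
  rw [parSY_boxEquiv, diagT]
  exact (parTaxiV_bondCfg (three_le_sitesPerDir i) (origT i) (finRange_eq d') (by simp) (witV hN)).1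

/-- ★ BACK along the two unexcited sides: `U₀(Γ_{e₀+e₁, 0}) = 1`. [cite: Balaban1985BackgroundPropagators, (3.3), (3.8) pp.391–392, (3.40) p.397] -/
theorem parSY_witCfg_back (hN : 2 ≤ N) : parSY i (witCfg i hN) (boxEquiv i.hN (diagT i)) (boxEquiv i.hN (origT i)) = 1 := by
  rw [parSY_boxEquiv, diagT]
  exact (parTaxiV_bondCfg (three_le_sitesPerDir i) (origT i) (finRange_eq d') (by simp) (witV hN)).2

/-- ★★★ **THE KERNEL WITNESS OF LOCATED FINDING R7** (ref-A g15 WATCH-S ASK (ii)): at EVERY k-level index of dimension `d + 1 ≥ 2` and every `N ≥ 2`, the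
explicit one-plaquette configuration `witCfg` (the unitary `diag(−1, 1, …, 1)` on the single bond `⟨e₀, e₀ + e₁⟩`, `1` elsewhere) makes def-Y's v2∕v3 letter
`deltaPrimeAY i (parSY i) U₀` NON-symmetric for the trace pairing: the taxicab contours `0 → e₀ → e₀+e₁` and `e₀+e₁ → e₁ → 0` are the two halves of the
plaquette, `U₀(Γ_{0,z}) = V`, `U₀(Γ_{z,0}) = 1`, and conjugation by `V` moves `E₀₁`.  (Not (3.35)-small: `‖V − 1‖ = 2`; the (3.35)-regular rescaling
`V_ε = diag(e^{iε}, e^{−iε}, 1, …)` has the same contour algebra — recorded, not typed.) [cite: Balaban1985BackgroundPropagators, (3.24) p.394, (3.40) p.397, (3.3) p.391] -/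
theorem not_isSymmTr_deltaPrimeAY_parSY_witCfg (hN : 2 ≤ N) :
    ¬ IsSymmTr (fun _ => (1 : ℝ)) (deltaPrimeAY i (parSY i) (witCfg i hN)) := by
  refine not_isSymmTr_deltaPrimeAY_parSY i (witCfg i hN) (witCfg_mem_unitary i hN) (boxEquiv i.hN (diagT i))
    (Matrix.single ⟨0, by omega⟩ ⟨1, by omega⟩ (1 : ℂ)) ?_
  rw [cornerY_diagT, parSY_witCfg_out, parSY_witCfg_back, inv_one]
  intro h
  refine R_witV_ne hN ?_
  rw [← h, B9Eq39Adjoint.R_def]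
  simp

/-- ★★★ idem, packaged over the index binder `d ≥ 1`: an explicit unitary-valued `U₀` with `¬ IsSymmTr 1 (deltaPrimeAY i (parSY i) U₀)` EXISTS at every index.
[cite: Balaban1985BackgroundPropagators, (3.24) p.394, (3.40) p.397] -/
theorem exists_not_isSymmTr_deltaPrimeAY_parSY {d : ℕ} (hd1 : 1 ≤ d) {hd : 1 ≤ d + 1} {hL : Odd (ℓ + 1) ∧ 1 < ℓ + 1} (i : KIdx d ℓ hd hL b₀ b₁)
    (hN : 2 ≤ N) :
    ∃ U : CfgY (Matrix (Fin N) (Fin N) ℂ) i,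
      (∀ μ y, ((U μ y : (Matrix (Fin N) (Fin N) ℂ)ˣ) : Matrix (Fin N) (Fin N) ℂ) ∈ unitary (Matrix (Fin N) (Fin N) ℂ)) ∧
      ¬ IsSymmTr (fun _ => (1 : ℝ)) (deltaPrimeAY i (parSY i) U) := by
  obtain ⟨d', rfl⟩ := Nat.exists_eq_add_of_le' hd1
  exact ⟨witCfg i hN, witCfg_mem_unitary i hN, not_isSymmTr_deltaPrimeAY_parSY_witCfg i hN⟩

end Witness

end

end Literature.MathematicalPhysics.QuantumFieldTheory.Balaban1983to89.B9Thm311DeltaPrimeWitness
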